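/-
HONEST FRAMING: certified error envelopes and provably optimal rounding/accumulation schemes for
low-precision formats under stated cost models; every table by two implementations; no hardware
or vendor claims.
-/
import Summits.Ventures.CertifiedArithmetic.LowPrec.OptDemotionRoutingR32

/-!
# The demotion law (Theorem T8), part 10i-0: node rules for two- and three-bit coordinates (upper and lower)

Small infrastructure for the all-`q` three-family rows (parts 10i LEMMA Φ3, 10j R33):
* `split_pair_le` / `treeBR_pair_node_le` — THE NODE RULE FOR A TWO-BIT CONFIGURATION `{0, -i}`
  (`1 ≤ i ≤ q-1`) as an UPPER bound: every valid split of part 8a is dominated by one of the four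
  injected options `({0,-i} | {-q})`, `({0} | {-i,-q})` in either orientation (the treeBR form of
  part 8c's `treeQf_excess_node`);
* `treeBR_triple_node_ge` — the four `A`-oriented injected options of a three-bit configuration
  `{0,-a,-b}` as LOWER bounds of the node value (companions of part 10h-b `treeBR_pair_node_ge`);
* `two_treeBR_triple_le` — (MC) at a three-bit configuration in the direction of its lowest bit
  (`2 BR{0,-s,-i} ≤ BR{0,-s,-(i-1)} + BR{0,-s}`, `s + 2 ≤ i`);
* `treeBR_gc0_pair`, `treeBR_gc_pair` — part 10d's gap convexity (opt R28) on single-bit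
  coordinates `x_c = BR{0,-c}` in the two shapes used by LEMMA Φ3, INCLUDING the degenerate
  equality cases (`x_c | x₀, x_j` for `j ≤ c`; `x_{c+1} | x_c, x_j` for `c + 1 ≤ j`).
-/

namespace Summit.Ventures.CertifiedArithmetic.LowPrec.Opt

open Literature.ComputerArithmetic.JeannerodRump2018
open Literature.ComputerArithmetic.JeannerodRump2018.SumTree

section PairNode

variable {q : ℕ}

/-! ## The node rule for a two-bit configuration, as an upper bound -/

/-- The two `A`-oriented options of `{0,-i}`: a valid split whose first part holds the top bit is
dominated by `({0,-i} | {-q})` or `({0} | {-i,-q})`. -/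
theorem split_pair_le_left (hq : 1 ≤ q) (A B : SumTree) {i : ℕ} (hi : 1 ≤ i) (hiq : i + 1 ≤ q)
    {A' B' : Finset ℤ} (h : (A', B') ∈ splits q ({0, -(i : ℤ)} : Finset ℤ) 0) (h0 : (0 : ℤ) ∈ A') :
    treeBR q A A' + treeBR q B B' ≤
      max (treeBR q A {0, -(i : ℤ)} + treeBR q B {-(q : ℤ)})
          (treeBR q A {0} + treeBR q B {-(i : ℤ), -(q : ℤ)}) := by
  classical
  obtain ⟨hA, hB, hdisj, hcov, hrA, hrB⟩ := of_mem_splits (A := A') (B := B') h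
  rw [zero_sub] at hA hB
  have hιA : -(q : ℤ) ∉ A' := fun hι => not_routable_of_mem_mem hrA h0 (by rwa [zero_sub])
  have hBsub : ∀ z, z ∈ B' → z = -(q : ℤ) ∨ (z ∈ ({0, -(i : ℤ)} : Finset ℤ) ∧ z ∉ A') := by
    intro z hz
    have hzA : z ∉ A' := fun hzA => Finset.disjoint_left.1 hdisj hzA hz
    rcases Finset.mem_insert.1 (hB hz) with hz' | hz'
    · exact Or.inl hz'
    · exact Or.inr ⟨hz', hzA⟩
  have hRlow : Routable q ({-(i : ℤ), -(q : ℤ)} : Finset ℤ) := by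
    intro x hx y hy
    simp only [Finset.mem_insert, Finset.mem_singleton] at hx hy
    rcases hx with rfl | rfl <;> rcases hy with rfl | rfl <;> omega
  by_cases hiA : -(i : ℤ) ∈ A'
  · -- A' = {0,-i}, B' ⊆ {-q}
    have hA'eq : A' = {0, -(i : ℤ)} := by
      ext z
      simp only [Finset.mem_insert, Finset.mem_singleton]
      constructor
      · intro hz
        have := hA hz
        simp only [Finset.mem_insert, Finset.mem_singleton] at this
        rcases this with rfl | rfl | rfl
        · exact absurd hz hιA
        · exact Or.inl rfl
        · exact Or.inr rfl
      · rintro (rfl | rfl)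
        · exact h0
        · exact hiA
    have hB'sub : B' ⊆ ({-(q : ℤ)} : Finset ℤ) := by
      intro z hz
      rcases hBsub z hz with rfl | ⟨hzS, hzA⟩
      · simp
      · simp only [Finset.mem_insert, Finset.mem_singleton] at hzS
        rcases hzS with rfl | rfl
        · exact absurd h0 hzA
        · exact absurd hiA hzA
    rw [hA'eq]
    exact le_trans (add_le_add le_rfl (treeBR_le_of_subset hq B hB'sub (routable_singleton hq _)))
      (le_max_left _ _)
  · -- A' = {0}, B' ⊆ {-i,-q}
    have hA'eq : A' = {0} := by
      ext z
      simp only [Finset.mem_singleton]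
      constructor
      · intro hz
        have := hA hz
        simp only [Finset.mem_insert, Finset.mem_singleton] at this
        rcases this with rfl | rfl | rfl
        · exact absurd hz hιA
        · rfl
        · exact absurd hz hiA
      · rintro rfl; exact h0
    have hB'sub : B' ⊆ ({-(i : ℤ), -(q : ℤ)} : Finset ℤ) := by
      intro z hz
      rcases hBsub z hz with rfl | ⟨hzS, hzA⟩
      · simp
      · simp only [Finset.mem_insert, Finset.mem_singleton] at hzS ⊢
        rcases hzS with rfl | rfl
        · exact absurd h0 hzA
        · exact Or.inl rfl
    rw [hA'eq]
    exact le_trans (add_le_add le_rfl (treeBR_le_of_subset hq B hB'sub hRlow)) (le_max_right _ _)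

/-- **THE NODE RULE FOR A TWO-BIT CONFIGURATION**: every valid split of `{0,-i}` (`1 ≤ i ≤ q-1`) is
dominated by one of the four injected options. -/
theorem split_pair_le (hq : 1 ≤ q) (A B : SumTree) {i : ℕ} (hi : 1 ≤ i) (hiq : i + 1 ≤ q)
    {A' B' : Finset ℤ} (h : (A', B') ∈ splits q ({0, -(i : ℤ)} : Finset ℤ) 0) :
    treeBR q A A' + treeBR q B B' ≤
      max (max (treeBR q A {0, -(i : ℤ)} + treeBR q B {-(q : ℤ)})
              (treeBR q A {0} + treeBR q B {-(i : ℤ), -(q : ℤ)}))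
        (max (treeBR q B {0, -(i : ℤ)} + treeBR q A {-(q : ℤ)})
              (treeBR q B {0} + treeBR q A {-(i : ℤ), -(q : ℤ)})) := by
  by_cases h0 : (0 : ℤ) ∈ A'
  · exact le_trans (split_pair_le_left hq A B hi hiq h h0) (le_max_left _ _)
  · obtain ⟨-, -, -, hcov, -, -⟩ := of_mem_splits (A := A') (B := B') h
    have h0B : (0 : ℤ) ∈ B' := by
      have := hcov (show (0 : ℤ) ∈ ({0, -(i : ℤ)} : Finset ℤ) by simp)
      rcases Finset.mem_union.1 this with h' | h'
      · exact absurd h' h0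
      · exact h'
    have := split_pair_le_left hq B A hi hiq (swap_mem_splits h) h0B
    rw [add_comm] at this
    exact le_trans this (le_max_right _ _)

/-- THE VALUE OF A TWO-BIT CONFIGURATION AT A NODE is `1 +` at most the best of the four injected
options. -/
theorem treeBR_pair_node_le (hq : 1 ≤ q) (A B : SumTree) {i : ℕ} (hi : 1 ≤ i) (hiq : i + 1 ≤ q)
    {R : ℚ} (hR : 0 ≤ R)
    (h4 : max (max (treeBR q A {0, -(i : ℤ)} + treeBR q B {-(q : ℤ)})
              (treeBR q A {0} + treeBR q B {-(i : ℤ), -(q : ℤ)}))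
        (max (treeBR q B {0, -(i : ℤ)} + treeBR q A {-(q : ℤ)})
              (treeBR q B {0} + treeBR q A {-(i : ℤ), -(q : ℤ)})) ≤ R) :
    treeBR q (.node A B) {0, -(i : ℤ)} ≤ 1 + R := by
  have hne : ({0, -(i : ℤ)} : Finset ℤ).Nonempty := Finset.insert_nonempty _ _
  have hmax : ({0, -(i : ℤ)} : Finset ℤ).max' hne = 0 := by
    refine le_antisymm (Finset.max'_le _ hne _ fun z hz => ?_) (Finset.le_max' _ _ (by simp))
    simp only [Finset.mem_insert, Finset.mem_singleton] at hz; omega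
  have h := treeBRw_node_le (q := q) (W := fun e => (2 : ℚ) ^ e) (a := A) (b := B) hne hR
    (fun AB hAB => by
      rw [hmax] at hAB
      have := split_pair_le hq A B hi hiq (A' := AB.1) (B' := AB.2) hAB
      unfold treeBR at this
      exact le_trans this h4)
  rw [hmax, zpow_zero] at h
  exact h

/-! ## Lower bounds: the four `A`-oriented options of a three-bit configuration -/

/-- LOWER BOUNDS AT A NODE for `BR{0,-a,-b}` (`1 ≤ a < b ≤ q-1`): the four `A`-oriented injected
options `({0} ∪ P | ({-a,-b} ∖ P) ∪ {-q})`. -/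
theorem treeBR_triple_node_ge (hq : 1 ≤ q) (A B : SumTree) {a b : ℕ} (ha : 1 ≤ a) (hab : a < b)
    (hbq : b + 1 ≤ q) :
    1 + (treeBR q A {0, -(a : ℤ), -(b : ℤ)} + treeBR q B {-(q : ℤ)}) ≤
        treeBR q (.node A B) {0, -(a : ℤ), -(b : ℤ)} ∧
      1 + (treeBR q A {0, -(a : ℤ)} + treeBR q B {-(b : ℤ), -(q : ℤ)}) ≤
        treeBR q (.node A B) {0, -(a : ℤ), -(b : ℤ)} ∧
      1 + (treeBR q A {0, -(b : ℤ)} + treeBR q B {-(a : ℤ), -(q : ℤ)}) ≤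
        treeBR q (.node A B) {0, -(a : ℤ), -(b : ℤ)} ∧
      1 + (treeBR q A {0} + treeBR q B {-(a : ℤ), -(b : ℤ), -(q : ℤ)}) ≤
        treeBR q (.node A B) {0, -(a : ℤ), -(b : ℤ)} := by
  classical
  set S : Finset ℤ := {0, -(a : ℤ), -(b : ℤ)} with hSdef
  have hne : S.Nonempty := Finset.insert_nonempty _ _
  have hmax : S.max' hne = 0 := by
    refine le_antisymm (Finset.max'_le _ hne _ fun z hz => ?_) (Finset.le_max' _ _ (by simp [hSdef]))
    simp only [hSdef, Finset.mem_insert, Finset.mem_singleton] at hz; omega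
  have hRall : Routable q (insert ((0 : ℤ) - q) S) → False := fun h =>
    not_routable_of_mem_mem h (e := 0) (by simp [hSdef]) (by simp)
  have hqz : (1 : ℤ) ≤ q := by exact_mod_cast hq
  -- routability of every part
  have rout : ∀ T : Finset ℤ, T ⊆ insert ((0 : ℤ) - q) S → ¬ ((0 : ℤ) ∈ T ∧ (0 : ℤ) - q ∈ T) →
      Routable q T := by
    intro T hT hno x hx y hy
    have hx' := hT hx; have hy' := hT hy
    simp only [hSdef, Finset.mem_insert, Finset.mem_singleton] at hx' hy'
    rcases hx' with rfl | rfl | rfl | rfl <;> rcases hy' with rfl | rfl | rfl | rfl <;>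
      first | omega | exact (hno ⟨hx, hy⟩).elim
  -- the generic injected split with first part `insert 0 P`
  have key : ∀ P : Finset ℤ, P ⊆ ({-(a : ℤ), -(b : ℤ)} : Finset ℤ) →
      1 + (treeBR q A (insert 0 P) + treeBR q B (insert ((0 : ℤ) - q) S \ insert 0 P)) ≤
        treeBR q (.node A B) S := by
    intro P hP
    have hAsub : insert 0 P ⊆ insert ((0 : ℤ) - q) S := by
      intro z hz
      rcases Finset.mem_insert.1 hz with rfl | hz
      · simp [hSdef]
      · have := hP hz
        simp only [Finset.mem_insert, Finset.mem_singleton] at this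
        simp only [hSdef, Finset.mem_insert, Finset.mem_singleton]
        omega
    have hm : (insert 0 P, insert ((0 : ℤ) - q) S \ insert 0 P) ∈ splits q S (S.max' hne) := by
      rw [hmax]
      refine mem_splits.2 ⟨Or.inr ⟨hAsub, rfl⟩, rout _ hAsub ?_, rout _ Finset.sdiff_subset ?_⟩
      · rintro ⟨-, h2⟩
        rcases Finset.mem_insert.1 h2 with h2 | h2
        · omega
        · have := hP h2
          simp only [Finset.mem_insert, Finset.mem_singleton] at this; omega
      · rintro ⟨h1, -⟩
        rw [Finset.mem_sdiff] at h1
        exact h1.2 (Finset.mem_insert_self _ _)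
    have := split_le_treeBRw_node (q := q) (W := fun e => (2 : ℚ) ^ e) (a := A) (b := B) hne hm
    rw [hmax, zpow_zero] at this
    exact this
  refine ⟨?_, ?_, ?_, ?_⟩
  · have h := key {-(a : ℤ), -(b : ℤ)} (fun z hz => hz)
    have e1 : insert (0 : ℤ) ({-(a : ℤ), -(b : ℤ)} : Finset ℤ) = S := rfl
    have e2 : insert ((0 : ℤ) - q) S \ insert 0 {-(a : ℤ), -(b : ℤ)} = {-(q : ℤ)} := by
      ext z
      simp only [hSdef, Finset.mem_sdiff, Finset.mem_insert, Finset.mem_singleton]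
      omega
    rw [e2] at h
    exact h
  · have h := key {-(a : ℤ)} (by intro z hz; rw [Finset.mem_singleton] at hz; simp [hz])
    have e2 : insert ((0 : ℤ) - q) S \ insert 0 {-(a : ℤ)} = {-(b : ℤ), -(q : ℤ)} := by
      ext z
      simp only [hSdef, Finset.mem_sdiff, Finset.mem_insert, Finset.mem_singleton]
      omega
    rw [e2] at h
    exact h
  · have h := key {-(b : ℤ)} (by intro z hz; rw [Finset.mem_singleton] at hz; simp [hz])
    have e2 : insert ((0 : ℤ) - q) S \ insert 0 {-(b : ℤ)} = {-(a : ℤ), -(q : ℤ)} := by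
      ext z
      simp only [hSdef, Finset.mem_sdiff, Finset.mem_insert, Finset.mem_singleton]
      omega
    rw [e2] at h
    exact h
  · have h := key ∅ (Finset.empty_subset _)
    have e1 : insert (0 : ℤ) (∅ : Finset ℤ) = {0} := rfl
    have e2 : insert ((0 : ℤ) - q) S \ insert 0 ∅ = {-(a : ℤ), -(b : ℤ), -(q : ℤ)} := by
      ext z
      simp only [hSdef, Finset.mem_sdiff, Finset.mem_insert, Finset.mem_singleton, e1]
      omega
    rw [e2, e1] at h
    exact h

/-! ## (MC) at a three-bit configuration in the direction of its lowest bit -/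

/-- (MC) for `{0,-s,-i}` with `1 ≤ s`, `s + 2 ≤ i ≤ q - 1` in the direction of the bit `-i` (no run):
`2 BR{0,-s,-i} ≤ BR{0,-s,-(i-1)} + BR{0,-s}`. -/
theorem two_treeBR_triple_le (t : SumTree) {s i : ℕ} (hs : 1 ≤ s) (hsi : s + 2 ≤ i) (hiq : i + 1 ≤ q) :
    2 * treeBR q t {0, -(s : ℤ), -(i : ℤ)} ≤
      treeBR q t {0, -(s : ℤ), -((i : ℤ) - 1)} + treeBR q t {0, -(s : ℤ)} := by
  classical
  have hS : Routable q ({0, -(s : ℤ), -(i : ℤ)} : Finset ℤ) := by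
    intro x hx y hy
    simp only [Finset.mem_insert, Finset.mem_singleton] at hx hy
    rcases hx with rfl | rfl | rfl <;> rcases hy with rfl | rfl | rfl <;> omega
  have hS' : Routable q ({0, -(s : ℤ), -((i : ℤ) - 1)} : Finset ℤ) := by
    intro x hx y hy
    simp only [Finset.mem_insert, Finset.mem_singleton] at hx hy
    rcases hx with rfl | rfl | rfl <;> rcases hy with rfl | rfl | rfl <;> omega
  have hrun : ∀ n : ℕ, n ≤ 0 → -(i : ℤ) + (n : ℤ) ∈ ({0, -(s : ℤ), -(i : ℤ)} : Finset ℤ) := by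
    intro n hn
    have : n = 0 := by omega
    subst this; simp
  have hβ' : -(i : ℤ) + (((0 : ℕ) : ℤ) + 1) ∉ ({0, -(s : ℤ), -(i : ℤ)} : Finset ℤ) := by
    simp only [Nat.cast_zero, zero_add, Finset.mem_insert, Finset.mem_singleton]; omega
  have e1 : insert (-(i : ℤ) + (((0 : ℕ) : ℤ) + 1))
      (({0, -(s : ℤ), -(i : ℤ)} : Finset ℤ) \ (Finset.range (0 + 1)).image (fun n : ℕ => -(i : ℤ) + (n : ℤ))) =
        ({0, -(s : ℤ), -((i : ℤ) - 1)} : Finset ℤ) := by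
    ext z
    simp only [Nat.cast_zero, zero_add, Finset.range_one, Finset.image_singleton, add_zero,
      Finset.mem_insert, Finset.mem_sdiff, Finset.mem_singleton]
    omega
  have e2 : ({0, -(s : ℤ), -(i : ℤ)} : Finset ℤ).erase (-(i : ℤ)) = {0, -(s : ℤ)} := by
    ext z
    simp only [Finset.mem_erase, Finset.mem_insert, Finset.mem_singleton]
    omega
  have hmc := treeBR_midconvex (q := q) t hS (β := -(i : ℤ)) (j := 0) hrun hβ' (by rw [e1]; exact hS')
  rw [e1, e2] at hmc
  exact hmc

/-! ## Gap convexity on single-bit coordinates (with the degenerate cases) -/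

/-- GAP CONVEXITY `x_c | x₀, x_j` for `1 ≤ j ≤ c ≤ q-1` (part 10d `treeBR_gap_convex₀`; equality of the
two sides' coordinates when `j = c`): `2^-j BR{0,-c} ≤ (2^-j - 2^-c) BR{0} + 2^-c BR{0,-j}`. -/
theorem treeBR_gc0_pair (t : SumTree) {j c : ℕ} (hj : 1 ≤ j) (hjc : j ≤ c) (hcq : c + 1 ≤ q) :
    (2 : ℚ) ^ (-(j : ℤ)) * treeBR q t {0, -(c : ℤ)} ≤
      ((2 : ℚ) ^ (-(j : ℤ)) - (2 : ℚ) ^ (-(c : ℤ))) * treeBR q t {0} +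
        (2 : ℚ) ^ (-(c : ℤ)) * treeBR q t {0, -(j : ℤ)} := by
  rcases Nat.lt_or_ge j c with hlt | hge
  · have h := treeBR_gap_convex₀ (q := q) t (S := ({0} : Finset ℤ)) (m₂ := -(c : ℤ)) (m₃ := -(j : ℤ))
      (by omega) (by simp; omega) (by simp; omega) (by intro s hs; rw [Finset.mem_singleton] at hs; omega)
      (by
        intro x hx y hy
        simp only [Finset.mem_insert, Finset.mem_singleton] at hx hy
        rcases hx with rfl | rfl <;> rcases hy with rfl | rfl <;> omega)
      (by
        intro x hx y hy
        simp only [Finset.mem_insert, Finset.mem_singleton] at hx hy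
        rcases hx with rfl | rfl <;> rcases hy with rfl | rfl <;> omega)
    have e1 : (insert (-(c : ℤ)) ({0} : Finset ℤ)) = {0, -(c : ℤ)} := Finset.pair_comm _ _
    have e2 : (insert (-(j : ℤ)) ({0} : Finset ℤ)) = {0, -(j : ℤ)} := Finset.pair_comm _ _
    rw [e1, e2] at h
    exact h
  · have hjc' : j = c := le_antisymm hjc hge
    subst hjc'
    linarith

/-- GAP CONVEXITY `x_{c+1} | x_c, x_j` for `1 ≤ c`, `c + 1 ≤ j ≤ q-1` (part 10d `treeBR_gap_convex`;
equality when `j = c + 1`):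
`(2^-c - 2^-j) BR{0,-(c+1)} ≤ (2^-(c+1) - 2^-j) BR{0,-c} + (2^-c - 2^-(c+1)) BR{0,-j}`. -/
theorem treeBR_gc_pair (t : SumTree) {j c : ℕ} (hc : 1 ≤ c) (hcj : c + 1 ≤ j) (hjq : j + 1 ≤ q) :
    ((2 : ℚ) ^ (-(c : ℤ)) - (2 : ℚ) ^ (-(j : ℤ))) * treeBR q t {0, -((c : ℤ) + 1)} ≤
      ((2 : ℚ) ^ (-((c : ℤ) + 1)) - (2 : ℚ) ^ (-(j : ℤ))) * treeBR q t {0, -(c : ℤ)} +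
        ((2 : ℚ) ^ (-(c : ℤ)) - (2 : ℚ) ^ (-((c : ℤ) + 1))) * treeBR q t {0, -(j : ℤ)} := by
  rcases Nat.lt_or_ge (c + 1) j with hlt | hge
  · have rpair : ∀ e : ℤ, e < 0 → 1 - (q : ℤ) ≤ e → Routable q (insert e ({0} : Finset ℤ)) := by
      intro e he heq x hx y hy
      simp only [Finset.mem_insert, Finset.mem_singleton] at hx hy
      rcases hx with rfl | rfl <;> rcases hy with rfl | rfl <;> omega
    have h := treeBR_gap_convex (q := q) t (S := ({0} : Finset ℤ)) (m₁ := -(j : ℤ)) (m₂ := -((c : ℤ) + 1))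
      (m₃ := -(c : ℤ)) (by omega) (by omega) (by simp; omega) (by simp; omega) (by simp; omega)
      (by intro s hs; rw [Finset.mem_singleton] at hs; omega)
      (rpair _ (by omega) (by omega)) (rpair _ (by omega) (by omega)) (rpair _ (by omega) (by omega))
    have e1 : (insert (-(c : ℤ)) ({0} : Finset ℤ)) = {0, -(c : ℤ)} := Finset.pair_comm _ _
    have e2 : (insert (-(j : ℤ)) ({0} : Finset ℤ)) = {0, -(j : ℤ)} := Finset.pair_comm _ _
    have e3 : (insert (-((c : ℤ) + 1)) ({0} : Finset ℤ)) = {0, -((c : ℤ) + 1)} := Finset.pair_comm _ _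
    rw [e1, e2, e3] at h
    linarith
  · have hj' : (j : ℤ) = (c : ℤ) + 1 := by omega
    rw [hj']
    linarith

end PairNode

end Summit.Ventures.CertifiedArithmetic.LowPrec.Opt
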